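import Literature.Analysis.FluidPDE.ClassicalDriftNSLocalEnergy
import Literature.Analysis.FluidPDE.LeraySeparationOfEnergyTools
import Literature.Analysis.FluidPDE.SobolevWholeSpace
import Literature.Analysis.FluidPDE.LerayHopf
import HarnessLib

/-!
# Leray's separation of energy (répartition de l'énergie cinétique à grande distance)

Analysis/FluidPDE file serving the discharge of
`Literature.Analysis.FluidPDE.leray_regularised_wellposed` (its `tail` field) and, through it, of
`leray_regularised_scheme_exists` / `leray_existence_R3` (`FluidPDE/NSLerayRegularised*`): the
**separation of energy** for Leray's regularised Navier–Stokes system (Leray 1934, Ch. V §27,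
(5.2)–(5.7); Ożański–Pooley 2018, Lemma 6.34; Robinson–Rodrigo–Sadowski 2016, Prop. 14.3), proved
here for every finite-energy classical solution of the drift system

  `∂ₜu + (w·∇)u = νΔu − ∇p`, `div u = div w = 0` on `(0, ∞) × E`, `dim E = 3`,

whose drift and pressure are subordinate to the velocity as Leray's are
(`‖w‖₂ ≤ ‖u‖₂`, `‖w‖₄ ≤ ‖u‖₄`, `‖p‖₂ ≤ C_p‖|w||u|‖₂` — for `w = J_εu`, `p = ΣRᵢRₖ(wᵢuₖ)` these are
Young's inequality and Plancherel, Ożański–Pooley 2018, Lemma 1.6 (i) and (6.85)), with the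
energy inequality and `u ∈ C([0,∞); L²)` (`LerayTailHyp`). The conclusion
(`exists_leray_separation_of_energy`) is in the shape of the `tail` field of
`IsLerayRegularisedScheme` / `leray_regularised_wellposed`:

  `∫_{|x|>R₂} |u(t)|² ≤ ∫_{|x|>R₁} |u(0)|² + C·C̄(M, t)/(R₂ − R₁)`, `0 < R₁ < R₂`, `t ≥ 0`,

for every `M ≥ ‖u(0)‖₂`, with `C̄ = lerayTailBound ν C_p K M t` (`≍ M³t^{1/4} + M²t^{1/2}`,
`K` the Sobolev constant of `H¹ ⊂ L⁶`) and an absolute `C` — uniform in the solution, hence in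
`ε`, which is the point of Leray's §27.

## The argument (Ożański–Pooley 2018, proof of Lemma 6.34)

With the smooth radial cutoff `θ = radialCutoff R₁ R₂` (`= 1` on `|x| ≤ R₁`, `= 0` on `|x| ≥ R₂`,
`|∇θ| ≤ C/(R₂ − R₁)`, `LeraySeparationOfEnergyTools`) in place of Leray's ramp:
1. the local energy identity for `θ` on `[s, t] ⊂ (0, ∞)` (`ClassicalDriftNSLocalEnergy`)
   subtracted from the energy inequality on `[s, t]` gives, discarding `2ν∫∫(1 − θ)|Du|² ≥ 0`,
   `∫(1 − θ)|u(t)|² ≤ ∫(1 − θ)|u(s)|² + ∫ₛᵗ|X(r)|dr` with the flux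
   `X = ∫|u|²⟪w,∇θ⟫ − 2ν∫⟪Du(∇θ),u⟫ + 2∫p⟪u,∇θ⟫` (`integral_one_sub_mul_norm_sq_le`);
2. slice-wise `|X| ≤ |∇θ|_∞ (‖u‖₄²‖w‖₂ + 2ν‖Du‖₂‖u‖₂ + 2‖p‖₂‖u‖₂)` (`enorm_tailFlux_le`), and with
   `‖p‖₂ ≤ C_p‖u‖₄²`, `‖u‖₄² ≤ ‖u‖₂^{1/2}(K‖Du‖₂)^{3/2}` (interpolation + Sobolev, `dim E = 3`),
   `‖u(r)‖₂ ≤ M`: `|X(r)| ≤ G(A₁ D(r)^{3/4} + A₂ D(r)^{1/2})`, `D(r) = ∫|Du(r)|²_F`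
   (`enorm_tailFlux_slice_le`);
3. Hölder in time and `∫₀ᵗ D ≤ M²/(2ν)` (`lintegral_enorm_tailFlux_le`);
4. `s → 0⁺` by `L²`-continuity (`tendsto_integral_one_sub_mul_norm_sq`), and
   `1_{|x|>R₂} ≤ 1 − θ ≤ 1_{|x|>R₁}`.
All estimates are run in `ℝ≥0∞`, so that no slice integrability beyond the hypotheses is used.

## Mathlib / tree search

No separation-of-energy / far-field energy estimate in Mathlib or the tree (searched `tail`,
`separation`, `répartition`, `farField`, `exterior energy`): the tree states it only as the `tail`
field of `IsLerayRegularisedScheme` and inside the named facts `leray_regularised_wellposed`,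
`leray_regularised_scheme_exists`. Used from the tree: `radialCutoff` (`NewtonKernel`),
`eLpNorm_six_le_eLpNorm_fderiv_two` (`SobolevWholeSpace`), `ContinuousInLpOn` (`LerayHopf`),
`IsSmoothSpaceTimeOn` calculus (`SpaceTimeCalculus`, `ClassicalSolutionCalculus`),
`IsClassicalDriftNSSolutionOn.local_energy_identity` (`ClassicalDriftNSLocalEnergy`).

## References

* J. Leray, *Sur le mouvement d'un liquide visqueux emplissant l'espace*, Acta Math. 63 (1934),
  Ch. V §27, pp. 232–235, (5.2)–(5.7).
* W. S. Ożański, B. C. Pooley, *Leray's fundamental work on the Navier–Stokes equations: a modern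
  review*, LMS Lecture Note Ser. 452 (CUP 2018) = arXiv:1708.09787, Lemma 6.34 and its proof,
  (6.85)–(6.86).
* J. C. Robinson, J. L. Rodrigo, W. Sadowski, *The three-dimensional Navier–Stokes equations*
  (CUP 2016), Prop. 14.3.
-/

noncomputable section

open MeasureTheory TopologicalSpace Set Function Filter InnerProductSpace
open scoped ENNReal NNReal Laplacian RealInnerProductSpace ContDiff Topology

namespace Literature.Analysis.FluidPDE

/-! ### Finite-energy classical solutions of the drift system: the hypotheses of the tail estimate -/

section Hyp

variable {E : Type*} [NormedAddCommGroup E] [InnerProductSpace ℝ E] [FiniteDimensional ℝ E]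
  [MeasurableSpace E] [BorelSpace E]

/-- The slice dissipation `∫ |Du(r)|²_F dx ∈ [0, ∞]` (Frobenius norm of the classical gradient),
the integrand of the dissipation term of `leray_regularised_wellposed`. [folklore] -/
def eDissipationSlice (u : ℝ → E → E) (r : ℝ) : ℝ≥0∞ :=
  ∫⁻ x, ENNReal.ofReal (frobeniusNormSq (fderiv ℝ (u r) x))

/-- Unfolding `eDissipationSlice`. [folklore] -/
theorem eDissipationSlice_apply (u : ℝ → E → E) (r : ℝ) :
    eDissipationSlice u r = ∫⁻ x, ENNReal.ofReal (frobeniusNormSq (fderiv ℝ (u r) x)) :=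
  rfl

/-- **Hypotheses of Leray's separation of energy** for the drift system
`∂ₜu + (w·∇)u = νΔu − ∇p`, `div u = div w = 0` (for Leray's regularised system `w = J_ε u`,
`p = Σᵢₖ RᵢRₖ((J_εu)ᵢuₖ)`): a classical solution on the open time half-line `(0, ∞)` which is
`L²`-continuous on `[0, ∞)` (so the datum `u 0` is attained), with finite dissipation on bounded
time intervals and the energy inequality between any two times `0 ≤ s ≤ t`, whose drift is
subordinate to the velocity in `L²` and `L⁴` (`‖J_εu‖_q ≤ ‖u‖_q`, Ożański–Pooley 2018,
Lemma 1.6 (i)) and whose pressure obeys the Calderón–Zygmund/Plancherel bound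
`‖p‖₂ ≤ C_p ‖|w||u|‖₂` (Ożański–Pooley 2018, (6.85): `‖p‖ ≤ C‖|J_εu||u|‖`). These are exactly the
properties of the regularised solution used in the proof of Ożański–Pooley 2018, Lemma 6.34
(Leray 1934, §27). [cite: OzanskiPooley2018, Lemma 6.34 (proof)] -/
structure LerayTailHyp (ν : ℝ) (Cp : ℝ≥0) (w u : ℝ → E → E) (p : ℝ → E → ℝ) : Prop where
  /-- `(w, u, p)` is a classical solution of the drift system on `(0, ∞) × E`. -/
  solution : IsClassicalDriftNSSolutionOn (Ioi 0) ν w u p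
  /-- `u ∈ C([0, ∞); L²(E))`. -/
  continuousInL2 : ContinuousInLpOn (Ici 0) 2 u
  /-- Finite dissipation on every `(0, T)`. -/
  dissipation_lt_top : ∀ T, ∫⁻ t in Ioo 0 T, eDissipationSlice u t < ⊤
  /-- The energy inequality `½‖u(t)‖² + ν∫ₛᵗ∫|Du|² ≤ ½‖u(s)‖²` for `0 ≤ s ≤ t`. -/
  energy_le : ∀ s t, 0 ≤ s → s ≤ t →
    VectorCalculus.kineticEnergy (u t) + ν * (∫⁻ τ in Ioo s t, eDissipationSlice u τ).toReal ≤
      VectorCalculus.kineticEnergy (u s)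
  /-- `‖w(t)‖_{L²} ≤ ‖u(t)‖_{L²}` for `t > 0`. -/
  drift_two : ∀ t, 0 < t → eLpNorm (w t) 2 volume ≤ eLpNorm (u t) 2 volume
  /-- `‖w(t)‖_{L⁴} ≤ ‖u(t)‖_{L⁴}` for `t > 0`. -/
  drift_four : ∀ t, 0 < t → eLpNorm (w t) 4 volume ≤ eLpNorm (u t) 4 volume
  /-- `‖p(t)‖_{L²} ≤ C_p ‖|w(t)||u(t)|‖_{L²}` for `t > 0`. -/
  pressure_two : ∀ t, 0 < t →
    eLpNorm (p t) 2 volume ≤ Cp * eLpNorm (fun x => ‖w t x‖ * ‖u t x‖) 2 volume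

namespace LerayTailHyp

variable {ν : ℝ} {Cp : ℝ≥0} {w u : ℝ → E → E} {p : ℝ → E → ℝ}

/-- The slices `u t`, `t ≥ 0`, are in `L²`. [folklore] -/
theorem memLp (h : LerayTailHyp ν Cp w u p) {t : ℝ} (ht : 0 ≤ t) : MemLp (u t) 2 volume :=
  h.continuousInL2.1 t ht

/-- `‖v‖_{L²} = ofReal √(2 E(v))` for `v ∈ L²`. [folklore] -/
theorem eLpNorm_two_eq_ofReal_sqrt {v : E → E} (hv : MemLp v 2 volume) :
    eLpNorm v 2 volume = ENNReal.ofReal (Real.sqrt (2 * VectorCalculus.kineticEnergy v)) := by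
  rw [hv.eLpNorm_eq_integral_rpow_norm (by norm_num) (by norm_num)]
  congr 1
  rw [VectorCalculus.kineticEnergy, ← mul_assoc, mul_inv_cancel₀ two_ne_zero, one_mul,
    Real.sqrt_eq_rpow]
  simp only [ENNReal.toReal_ofNat, Real.rpow_two]
  norm_num

/-- The kinetic energy does not increase: `E(u(t)) ≤ E(u(0))` for `t ≥ 0` (`ν ≥ 0`). [folklore] -/
theorem kineticEnergy_le (h : LerayTailHyp ν Cp w u p) (hν : 0 ≤ ν) {t : ℝ} (ht : 0 ≤ t) :
    VectorCalculus.kineticEnergy (u t) ≤ VectorCalculus.kineticEnergy (u 0) := by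
  have := h.energy_le 0 t le_rfl ht
  nlinarith [ENNReal.toReal_nonneg (a := ∫⁻ τ in Ioo 0 t, eDissipationSlice u τ)]

/-- `‖u(t)‖_{L²} ≤ ‖u(0)‖_{L²}` for `t ≥ 0`. [folklore] -/
theorem eLpNorm_le (h : LerayTailHyp ν Cp w u p) (hν : 0 ≤ ν) {t : ℝ} (ht : 0 ≤ t) :
    eLpNorm (u t) 2 volume ≤ eLpNorm (u 0) 2 volume := by
  rw [eLpNorm_two_eq_ofReal_sqrt (h.memLp ht), eLpNorm_two_eq_ofReal_sqrt (h.memLp le_rfl)]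
  exact ENNReal.ofReal_le_ofReal (Real.sqrt_le_sqrt (by linarith [h.kineticEnergy_le hν ht]))

/-- If `‖u(0)‖_{L²} ≤ M` then `2 E(u(0)) ≤ M²`. [folklore] -/
theorem two_mul_kineticEnergy_le (h : LerayTailHyp ν Cp w u p) {M : ℝ} (hM0 : 0 ≤ M)
    (hM : eLpNorm (u 0) 2 volume ≤ ENNReal.ofReal M) :
    2 * VectorCalculus.kineticEnergy (u 0) ≤ M ^ 2 := by
  rw [eLpNorm_two_eq_ofReal_sqrt (h.memLp le_rfl), ENNReal.ofReal_le_ofReal_iff hM0] at hM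
  have h0 : 0 ≤ 2 * VectorCalculus.kineticEnergy (u 0) := by
    have := kineticEnergy_nonneg (u 0); positivity
  nlinarith [Real.sq_sqrt h0, Real.sqrt_nonneg (2 * VectorCalculus.kineticEnergy (u 0))]

/-- **The dissipation bound** `∫₀ᵗ∫|Du|² ≤ M²/(2ν)` when `‖u(0)‖_{L²} ≤ M` (energy inequality from
`0`). [folklore] -/
theorem lintegral_eDissipationSlice_le (h : LerayTailHyp ν Cp w u p) (hν : 0 < ν) {t : ℝ} (ht : 0 ≤ t)
    {M : ℝ} (hM0 : 0 ≤ M) (hM : eLpNorm (u 0) 2 volume ≤ ENNReal.ofReal M) :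
    ∫⁻ τ in Ioo 0 t, eDissipationSlice u τ ≤ ENNReal.ofReal (M ^ 2 / (2 * ν)) := by
  have hfin : ∫⁻ τ in Ioo 0 t, eDissipationSlice u τ ≠ ⊤ := (h.dissipation_lt_top t).ne
  have hen := h.energy_le 0 t le_rfl ht
  have hE0 := h.two_mul_kineticEnergy_le hM0 hM
  have hEt := kineticEnergy_nonneg (u t)
  rw [← ENNReal.ofReal_toReal hfin]
  refine ENNReal.ofReal_le_ofReal ?_
  rw [le_div_iff₀ (by positivity)]
  nlinarith

end LerayTailHyp

end Hyp


/-! ### The flux of the local energy identity and its slice bound -/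

section SliceBound

variable {E : Type*} [NormedAddCommGroup E] [InnerProductSpace ℝ E] [FiniteDimensional ℝ E]
  [MeasurableSpace E] [BorelSpace E]

/-- The **flux** of the local energy identity against the cutoff `θ`:
`X = ∫ |V|²⟪w, ∇θ⟫ − 2ν ∫ ⟪DV(∇θ), V⟫ + 2 ∫ P⟪V, ∇θ⟫` (the three terms
`∂ₖf (J_εu)ₖ|u|²`, `2∂ₖf uᵢ∂ₖuᵢ`, `2∂ᵢf p uᵢ` of Ożański–Pooley 2018, proof of Lemma 6.34;
Leray 1934, (5.3)). [folklore] -/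
def tailFlux (ν : ℝ) (θ : E → ℝ) (V wv : E → E) (P : E → ℝ) : ℝ :=
  (∫ x, ‖V x‖ ^ 2 * ⟪wv x, gradient θ x⟫) - 2 * ν * (∫ x, ⟪fderiv ℝ V x (gradient θ x), V x⟫) +
    2 * ∫ x, P x * ⟪V x, gradient θ x⟫

/-- Unfolding `tailFlux`. [folklore] -/
theorem tailFlux_def (ν : ℝ) (θ : E → ℝ) (V wv : E → E) (P : E → ℝ) :
    tailFlux ν θ V wv P = (∫ x, ‖V x‖ ^ 2 * ⟪wv x, gradient θ x⟫) -
      2 * ν * (∫ x, ⟪fderiv ℝ V x (gradient θ x), V x⟫) + 2 * ∫ x, P x * ⟪V x, gradient θ x⟫ :=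
  rfl

omit [FiniteDimensional ℝ E] [MeasurableSpace E] [BorelSpace E] in
/-- `‖∇θ(x)‖ = ‖Dθ(x)‖` (the Riesz isometry); a private copy of the tree's
`norm_gradient_eq_norm_fderiv` (`SchefferTestFunction`, disjoint import closure). [folklore] -/
private theorem norm_gradient_eq_norm_fderiv [CompleteSpace E] (θ : E → ℝ) (x : E) :
    ‖gradient θ x‖ = ‖fderiv ℝ θ x‖ := by
  simp [gradient]

/-- **The slice bound for the flux.** If `‖Dθ‖ ≤ G`, `V ∈ C¹`, `w, P` continuous and `ν ≥ 0`, then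
`|X| ≤ G ( ‖V‖₄² ‖w‖₂ + 2ν ‖DV‖₂ ‖V‖₂ + 2 ‖P‖₂ ‖V‖₂ )` (Cauchy–Schwarz; the step
"`≤ (R₂ − R₁)⁻¹ ∫₀ᵗ (2‖u‖‖∇u‖ + 2‖u‖‖p‖ + ‖J_εu‖‖u‖₄²)`" of Ożański–Pooley 2018, proof of Lemma 6.34),
stated in `ℝ≥0∞` so that no integrability is presupposed. [cite: OzanskiPooley2018, Lemma 6.34 (proof)] -/
theorem enorm_tailFlux_le {ν G : ℝ} (hν : 0 ≤ ν) (hG : 0 ≤ G) {θ : E → ℝ} {V wv : E → E}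
    {P : E → ℝ} (hθ : ∀ x, ‖fderiv ℝ θ x‖ ≤ G) (hV : ContDiff ℝ 1 V) (hwv : Continuous wv)
    (hP : Continuous P) :
    ‖tailFlux ν θ V wv P‖ₑ ≤ ENNReal.ofReal G *
      (eLpNorm V 4 volume ^ 2 * eLpNorm wv 2 volume +
        ENNReal.ofReal (2 * ν) * (eLpNorm (fderiv ℝ V) 2 volume * eLpNorm V 2 volume) +
        2 * (eLpNorm P 2 volume * eLpNorm V 2 volume)) := by
  haveI : CompleteSpace E := FiniteDimensional.complete ℝ E
  have hVm : AEStronglyMeasurable V volume := hV.continuous.aestronglyMeasurable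
  have hDVm : AEStronglyMeasurable (fderiv ℝ V) volume :=
    (hV.continuous_fderiv one_ne_zero).aestronglyMeasurable
  have hwm : AEStronglyMeasurable wv volume := hwv.aestronglyMeasurable
  have hPm : AEStronglyMeasurable P volume := hP.aestronglyMeasurable
  -- term 1: `|∫ |V|²⟪w, ∇θ⟫| ≤ G ‖V‖₄² ‖w‖₂`
  have h1 : ‖∫ x, ‖V x‖ ^ 2 * ⟪wv x, gradient θ x⟫‖ₑ ≤
      ENNReal.ofReal G * (eLpNorm V 4 volume ^ 2 * eLpNorm wv 2 volume) := by
    refine (enorm_integral_le_lintegral_enorm _).trans ?_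
    have hpt : ∀ x, ‖‖V x‖ ^ 2 * ⟪wv x, gradient θ x⟫‖ₑ ≤
        ENNReal.ofReal G * (‖(‖V x‖ ^ 2 : ℝ)‖ₑ * ‖wv x‖ₑ) := by
      intro x
      have hin : |⟪wv x, gradient θ x⟫| ≤ G * ‖wv x‖ := by
        rw [inner_gradient_right_eq_fderiv]
        calc |fderiv ℝ θ x (wv x)| = ‖fderiv ℝ θ x (wv x)‖ := (Real.norm_eq_abs _).symm
          _ ≤ ‖fderiv ℝ θ x‖ * ‖wv x‖ := ContinuousLinearMap.le_opNorm _ _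
          _ ≤ G * ‖wv x‖ := by gcongr; exact hθ x
      rw [enorm_mul, Real.enorm_eq_ofReal_abs ⟪wv x, gradient θ x⟫]
      calc ‖(‖V x‖ ^ 2 : ℝ)‖ₑ * ENNReal.ofReal |⟪wv x, gradient θ x⟫|
          ≤ ‖(‖V x‖ ^ 2 : ℝ)‖ₑ * ENNReal.ofReal (G * ‖wv x‖) := by gcongr
        _ = ENNReal.ofReal G * (‖(‖V x‖ ^ 2 : ℝ)‖ₑ * ‖wv x‖ₑ) := by
          rw [ENNReal.ofReal_mul hG, ofReal_norm]; ring
    calc ∫⁻ x, ‖‖V x‖ ^ 2 * ⟪wv x, gradient θ x⟫‖ₑ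
        ≤ ∫⁻ x, ENNReal.ofReal G * (‖(‖V x‖ ^ 2 : ℝ)‖ₑ * ‖wv x‖ₑ) := lintegral_mono hpt
      _ = ENNReal.ofReal G * ∫⁻ x, ‖(‖V x‖ ^ 2 : ℝ)‖ₑ * ‖wv x‖ₑ :=
          lintegral_const_mul' _ _ ENNReal.ofReal_ne_top
      _ ≤ ENNReal.ofReal G * (eLpNorm (fun x => ‖V x‖ ^ 2) 2 volume * eLpNorm wv 2 volume) := by
          gcongr
          exact lintegral_enorm_mul_enorm_le (f := fun x => ‖V x‖ ^ 2) (hVm.norm.pow 2) hwm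
      _ = ENNReal.ofReal G * (eLpNorm V 4 volume ^ 2 * eLpNorm wv 2 volume) := by
          rw [eLpNorm_norm_sq_two]
  -- term 2: `|∫ ⟪DV(∇θ), V⟫| ≤ G ‖DV‖₂ ‖V‖₂`
  have h2 : ‖∫ x, ⟪fderiv ℝ V x (gradient θ x), V x⟫‖ₑ ≤
      ENNReal.ofReal G * (eLpNorm (fderiv ℝ V) 2 volume * eLpNorm V 2 volume) := by
    refine (enorm_integral_le_lintegral_enorm _).trans ?_
    have hpt : ∀ x, ‖⟪fderiv ℝ V x (gradient θ x), V x⟫‖ₑ ≤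
        ENNReal.ofReal G * (‖fderiv ℝ V x‖ₑ * ‖V x‖ₑ) := by
      intro x
      have hin : |⟪fderiv ℝ V x (gradient θ x), V x⟫| ≤ G * (‖fderiv ℝ V x‖ * ‖V x‖) := by
        calc |⟪fderiv ℝ V x (gradient θ x), V x⟫|
            ≤ ‖fderiv ℝ V x (gradient θ x)‖ * ‖V x‖ := abs_real_inner_le_norm _ _
          _ ≤ ‖fderiv ℝ V x‖ * ‖gradient θ x‖ * ‖V x‖ := by
              gcongr; exact ContinuousLinearMap.le_opNorm _ _
          _ ≤ ‖fderiv ℝ V x‖ * G * ‖V x‖ := by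
              gcongr; rw [norm_gradient_eq_norm_fderiv]; exact hθ x
          _ = G * (‖fderiv ℝ V x‖ * ‖V x‖) := by ring
      rw [Real.enorm_eq_ofReal_abs]
      calc ENNReal.ofReal |⟪fderiv ℝ V x (gradient θ x), V x⟫|
          ≤ ENNReal.ofReal (G * (‖fderiv ℝ V x‖ * ‖V x‖)) := ENNReal.ofReal_le_ofReal hin
        _ = ENNReal.ofReal G * (‖fderiv ℝ V x‖ₑ * ‖V x‖ₑ) := by
          rw [ENNReal.ofReal_mul hG, ENNReal.ofReal_mul (norm_nonneg _), ofReal_norm, ofReal_norm]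
    calc ∫⁻ x, ‖⟪fderiv ℝ V x (gradient θ x), V x⟫‖ₑ
        ≤ ∫⁻ x, ENNReal.ofReal G * (‖fderiv ℝ V x‖ₑ * ‖V x‖ₑ) := lintegral_mono hpt
      _ = ENNReal.ofReal G * ∫⁻ x, ‖fderiv ℝ V x‖ₑ * ‖V x‖ₑ :=
          lintegral_const_mul' _ _ ENNReal.ofReal_ne_top
      _ ≤ ENNReal.ofReal G * (eLpNorm (fderiv ℝ V) 2 volume * eLpNorm V 2 volume) := by
          gcongr; exact lintegral_enorm_mul_enorm_le hDVm hVm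
  -- term 3: `|∫ P⟪V, ∇θ⟫| ≤ G ‖P‖₂ ‖V‖₂`
  have h3 : ‖∫ x, P x * ⟪V x, gradient θ x⟫‖ₑ ≤
      ENNReal.ofReal G * (eLpNorm P 2 volume * eLpNorm V 2 volume) := by
    refine (enorm_integral_le_lintegral_enorm _).trans ?_
    have hpt : ∀ x, ‖P x * ⟪V x, gradient θ x⟫‖ₑ ≤ ENNReal.ofReal G * (‖P x‖ₑ * ‖V x‖ₑ) := by
      intro x
      have hin : |⟪V x, gradient θ x⟫| ≤ G * ‖V x‖ := by
        rw [inner_gradient_right_eq_fderiv]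
        calc |fderiv ℝ θ x (V x)| = ‖fderiv ℝ θ x (V x)‖ := (Real.norm_eq_abs _).symm
          _ ≤ ‖fderiv ℝ θ x‖ * ‖V x‖ := ContinuousLinearMap.le_opNorm _ _
          _ ≤ G * ‖V x‖ := by gcongr; exact hθ x
      rw [enorm_mul, Real.enorm_eq_ofReal_abs ⟪V x, gradient θ x⟫]
      calc ‖P x‖ₑ * ENNReal.ofReal |⟪V x, gradient θ x⟫|
          ≤ ‖P x‖ₑ * ENNReal.ofReal (G * ‖V x‖) := by gcongr
        _ = ENNReal.ofReal G * (‖P x‖ₑ * ‖V x‖ₑ) := by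
          rw [ENNReal.ofReal_mul hG, ofReal_norm]; ring
    calc ∫⁻ x, ‖P x * ⟪V x, gradient θ x⟫‖ₑ
        ≤ ∫⁻ x, ENNReal.ofReal G * (‖P x‖ₑ * ‖V x‖ₑ) := lintegral_mono hpt
      _ = ENNReal.ofReal G * ∫⁻ x, ‖P x‖ₑ * ‖V x‖ₑ :=
          lintegral_const_mul' _ _ ENNReal.ofReal_ne_top
      _ ≤ ENNReal.ofReal G * (eLpNorm P 2 volume * eLpNorm V 2 volume) := by
          gcongr; exact lintegral_enorm_mul_enorm_le hPm hVm
  -- assemble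
  rw [tailFlux_def]
  set A := ∫ x, ‖V x‖ ^ 2 * ⟪wv x, gradient θ x⟫
  set B := ∫ x, ⟪fderiv ℝ V x (gradient θ x), V x⟫
  set C := ∫ x, P x * ⟪V x, gradient θ x⟫
  have h2ν : ‖2 * ν * B‖ₑ = ENNReal.ofReal (2 * ν) * ‖B‖ₑ := by
    rw [enorm_mul, Real.enorm_eq_ofReal (by positivity)]
  have h2C : ‖2 * C‖ₑ = 2 * ‖C‖ₑ := by
    rw [enorm_mul, Real.enorm_eq_ofReal zero_le_two, ENNReal.ofReal_ofNat]
  calc ‖A - 2 * ν * B + 2 * C‖ₑ ≤ ‖A - 2 * ν * B‖ₑ + ‖2 * C‖ₑ := enorm_add_le _ _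
    _ ≤ ‖A‖ₑ + ‖2 * ν * B‖ₑ + ‖2 * C‖ₑ := by gcongr; exact enorm_sub_le
    _ = ‖A‖ₑ + ENNReal.ofReal (2 * ν) * ‖B‖ₑ + 2 * ‖C‖ₑ := by rw [h2ν, h2C]
    _ ≤ ENNReal.ofReal G * (eLpNorm V 4 volume ^ 2 * eLpNorm wv 2 volume) +
        ENNReal.ofReal (2 * ν) * (ENNReal.ofReal G * (eLpNorm (fderiv ℝ V) 2 volume * eLpNorm V 2 volume)) +
        2 * (ENNReal.ofReal G * (eLpNorm P 2 volume * eLpNorm V 2 volume)) := by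
        gcongr
    _ = _ := by ring

end SliceBound


/-! ### The slice bound for finite-energy solutions in dimension three, and its time integral -/

section Three

variable {E : Type*} [NormedAddCommGroup E] [InnerProductSpace ℝ E] [FiniteDimensional ℝ E]
  [MeasurableSpace E] [BorelSpace E]

/-- `‖Du‖_{L²} ≤ (∫ |Du|²_F)^{1/2}`: the `L²` norm of the gradient with the operator norm is
dominated by the Frobenius dissipation. [folklore] -/
theorem eLpNorm_fderiv_two_le_eDissipationSlice_rpow (u : ℝ → E → E) (r : ℝ) :
    eLpNorm (fderiv ℝ (u r)) 2 volume ≤ eDissipationSlice u r ^ (1 / 2 : ℝ) := by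
  rw [eLpNorm_eq_lintegral_rpow_enorm_toReal (p := 2) (by norm_num) (by norm_num),
    ENNReal.toReal_ofNat, eDissipationSlice_apply]
  refine ENNReal.rpow_le_rpow (lintegral_mono fun x => ?_) (by norm_num)
  rw [ENNReal.rpow_two]
  exact enorm_opNorm_sq_le_ofReal_frobeniusNormSq _

/-- The Gagliardo–Nirenberg–Sobolev constant `K` of `H¹(E) ⊂ L⁶(E)` for fields `E → E`
(Mathlib's `SNormLESNormFDerivOfEqConst E volume 2`). [folklore] -/
abbrev sobolevSixConst (E : Type*) [NormedAddCommGroup E] [InnerProductSpace ℝ E]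
    [FiniteDimensional ℝ E] [MeasurableSpace E] [BorelSpace E] : ℝ≥0 :=
  SNormLESNormFDerivOfEqConst E (volume : Measure E) 2

/-- The coefficient of `D^{3/4}` in the slice majorant:
`A₁ = (1 + 2C_p) M^{1/2} K^{3/2} M` (as an extended real). [folklore] -/
def tailCoeffA (Cp K : ℝ≥0) (M : ℝ) : ℝ≥0∞ :=
  (1 + 2 * (Cp : ℝ≥0∞)) * (ENNReal.ofReal M ^ (1 / 2 : ℝ) * (K : ℝ≥0∞) ^ (3 / 2 : ℝ)) *
    ENNReal.ofReal M

/-- The coefficient of `D^{1/2}` in the slice majorant: `A₂ = 2ν M`. [folklore] -/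
def tailCoeffB (ν M : ℝ) : ℝ≥0∞ :=
  ENNReal.ofReal (2 * ν) * ENNReal.ofReal M

/-- `A₁ < ∞`. [folklore] -/
theorem tailCoeffA_ne_top (Cp K : ℝ≥0) (M : ℝ) : tailCoeffA Cp K M ≠ ⊤ := by
  unfold tailCoeffA
  refine ENNReal.mul_ne_top (ENNReal.mul_ne_top ?_ (ENNReal.mul_ne_top ?_ ?_))
    ENNReal.ofReal_ne_top
  · exact ENNReal.add_ne_top.2 ⟨ENNReal.one_ne_top, ENNReal.mul_ne_top (by norm_num) ENNReal.coe_ne_top⟩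
  · exact ENNReal.rpow_ne_top_of_nonneg (by norm_num) ENNReal.ofReal_ne_top
  · exact ENNReal.rpow_ne_top_of_nonneg (by norm_num) ENNReal.coe_ne_top

/-- `A₂ < ∞`. [folklore] -/
theorem tailCoeffB_ne_top (ν M : ℝ) : tailCoeffB ν M ≠ ⊤ :=
  ENNReal.mul_ne_top ENNReal.ofReal_ne_top ENNReal.ofReal_ne_top

namespace LerayTailHyp

variable {ν : ℝ} {Cp : ℝ≥0} {w u : ℝ → E → E} {p : ℝ → E → ℝ}

/-- `‖u(r)‖₄² ≤ ‖u(r)‖₂^{1/2} (K (∫|Du(r)|²)^{1/2})^{3/2}` in dimension three (the `L⁴` interpolation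
and the Sobolev inequality `‖u‖₆ ≤ K‖Du‖₂`; Ożański–Pooley 2018, (6.85)–(6.86):
`‖u‖₄² ≤ C‖∇u‖^{3/2}‖u‖^{1/2}`). [cite: OzanskiPooley2018, Lemma 6.34 (proof)] -/
theorem eLpNorm_four_sq_le (h : LerayTailHyp ν Cp w u p) (hE : Module.finrank ℝ E = 3) {r : ℝ}
    (hr : 0 < r) :
    eLpNorm (u r) 4 volume ^ 2 ≤ eLpNorm (u r) 2 volume ^ (1 / 2 : ℝ) *
      ((sobolevSixConst E : ℝ≥0∞) * eDissipationSlice u r ^ (1 / 2 : ℝ)) ^ (3 / 2 : ℝ) := by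
  have hC1 : ContDiff ℝ 1 (u r) := (h.solution.smooth_velocity.contDiff_slice hr).of_le (by norm_cast)
  have h2 : eLpNorm (u r) 2 volume < ⊤ := (h.memLp hr.le).eLpNorm_lt_top
  have hsob := eLpNorm_six_le_eLpNorm_fderiv_two (volume : Measure E) hE hC1 h2
  have h6 : eLpNorm (u r) 6 volume ≤ (sobolevSixConst E : ℝ≥0∞) * eDissipationSlice u r ^ (1 / 2 : ℝ) :=
    hsob.trans (by gcongr; exact eLpNorm_fderiv_two_le_eDissipationSlice_rpow u r)
  have h4 := eLpNorm_four_pow_four_le (μ := volume) hC1.continuous.aestronglyMeasurable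
  set q := eLpNorm (u r) 4 volume
  set a := eLpNorm (u r) 2 volume
  set Y := (sobolevSixConst E : ℝ≥0∞) * eDissipationSlice u r ^ (1 / 2 : ℝ)
  have hY : q ^ 4 ≤ a * Y ^ 3 := h4.trans (by gcongr)
  have e1 : q ^ 2 = (q ^ 4) ^ (1 / 2 : ℝ) := by
    rw [← ENNReal.rpow_natCast, ← ENNReal.rpow_natCast, ← ENNReal.rpow_mul]; norm_num
  have e2 : (a * Y ^ 3) ^ (1 / 2 : ℝ) = a ^ (1 / 2 : ℝ) * Y ^ (3 / 2 : ℝ) := by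
    rw [ENNReal.mul_rpow_of_nonneg _ _ (by norm_num), ← ENNReal.rpow_natCast Y 3, ← ENNReal.rpow_mul]
    norm_num
  rw [e1, ← e2]
  exact ENNReal.rpow_le_rpow hY (by norm_num)

/-- `‖p(r)‖₂ ≤ C_p ‖u(r)‖₄²` (the pressure bound (6.85) of Ożański–Pooley 2018 combined with
`‖|w||u|‖₂ ≤ ‖w‖₄‖u‖₄ ≤ ‖u‖₄²`). [cite: OzanskiPooley2018, (6.85)] -/
theorem eLpNorm_pressure_le (h : LerayTailHyp ν Cp w u p) {r : ℝ} (hr : 0 < r) :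
    eLpNorm (p r) 2 volume ≤ Cp * eLpNorm (u r) 4 volume ^ 2 := by
  have hum : AEStronglyMeasurable (u r) volume :=
    (h.solution.smooth_velocity.contDiff_slice hr).continuous.aestronglyMeasurable
  have hwm : AEStronglyMeasurable (w r) volume :=
    (h.solution.smooth_drift.contDiff_slice hr).continuous.aestronglyMeasurable
  refine (h.pressure_two r hr).trans ?_
  rw [sq]
  gcongr
  exact (eLpNorm_norm_mul_norm_two_le hwm hum).trans (by gcongr; exact h.drift_four r hr)

/-- **The slice majorant.** For a cutoff with `‖Dθ‖ ≤ G` and `‖u(0)‖₂ ≤ M`, the flux at time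
`r > 0` obeys `|X(r)| ≤ G (A₁ D(r)^{3/4} + A₂ D(r)^{1/2})`, `D(r) = ∫|Du(r)|²_F`
(Ożański–Pooley 2018, proof of Lemma 6.34: "`‖p‖` and `‖u‖₄²` enjoy the same bound
`C‖∇u‖^{3/2}‖u‖^{1/2}`", and `‖u(r)‖ ≤ ‖u₀‖`). [cite: OzanskiPooley2018, Lemma 6.34 (proof)] -/
theorem enorm_tailFlux_slice_le (h : LerayTailHyp ν Cp w u p) (hE : Module.finrank ℝ E = 3)
    (hν : 0 < ν) {M : ℝ} (hM : eLpNorm (u 0) 2 volume ≤ ENNReal.ofReal M)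
    {G : ℝ} (hG : 0 ≤ G) {θ : E → ℝ} (hθ : ∀ x, ‖fderiv ℝ θ x‖ ≤ G) {r : ℝ} (hr : 0 < r) :
    ‖tailFlux ν θ (u r) (w r) (p r)‖ₑ ≤ ENNReal.ofReal G *
      (tailCoeffA Cp (sobolevSixConst E) M * eDissipationSlice u r ^ (3 / 4 : ℝ) +
        tailCoeffB ν M * eDissipationSlice u r ^ (1 / 2 : ℝ)) := by
  have hC1 : ContDiff ℝ 1 (u r) := (h.solution.smooth_velocity.contDiff_slice hr).of_le (by norm_cast)
  have hwc : Continuous (w r) := (h.solution.smooth_drift.contDiff_slice hr).continuous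
  have hpc : Continuous (p r) := (h.solution.smooth_pressure.contDiff_slice hr).continuous
  have hX := enorm_tailFlux_le hν.le hG hθ hC1 hwc hpc (ν := ν) (P := p r)
  set q := eLpNorm (u r) 4 volume
  set a := eLpNorm (u r) 2 volume
  set D := eDissipationSlice u r
  set Kc : ℝ≥0∞ := (sobolevSixConst E : ℝ≥0∞)
  set m := ENNReal.ofReal M
  have ha : a ≤ m := (h.eLpNorm_le hν.le hr.le).trans hM
  have haw : eLpNorm (w r) 2 volume ≤ m := (h.drift_two r hr).trans ha
  have hdop : eLpNorm (fderiv ℝ (u r)) 2 volume ≤ D ^ (1 / 2 : ℝ) :=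
    eLpNorm_fderiv_two_le_eDissipationSlice_rpow u r
  have hp2 : eLpNorm (p r) 2 volume ≤ Cp * q ^ 2 := h.eLpNorm_pressure_le hr
  have hq2 : q ^ 2 ≤ m ^ (1 / 2 : ℝ) * (Kc ^ (3 / 2 : ℝ) * D ^ (3 / 4 : ℝ)) := by
    have := h.eLpNorm_four_sq_le hE hr
    have e : (Kc * D ^ (1 / 2 : ℝ)) ^ (3 / 2 : ℝ) = Kc ^ (3 / 2 : ℝ) * D ^ (3 / 4 : ℝ) := by
      rw [ENNReal.mul_rpow_of_nonneg _ _ (by norm_num), ← ENNReal.rpow_mul]; norm_num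
    rw [e] at this
    exact this.trans (by gcongr)
  refine hX.trans ?_
  rw [tailCoeffA, tailCoeffB]
  gcongr ENNReal.ofReal G * ?_
  calc q ^ 2 * eLpNorm (w r) 2 volume +
        ENNReal.ofReal (2 * ν) * (eLpNorm (fderiv ℝ (u r)) 2 volume * a) +
        2 * (eLpNorm (p r) 2 volume * a)
      ≤ m ^ (1 / 2 : ℝ) * (Kc ^ (3 / 2 : ℝ) * D ^ (3 / 4 : ℝ)) * m +
        ENNReal.ofReal (2 * ν) * (D ^ (1 / 2 : ℝ) * m) +
        2 * (Cp * (m ^ (1 / 2 : ℝ) * (Kc ^ (3 / 2 : ℝ) * D ^ (3 / 4 : ℝ))) * m) := by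
        gcongr
        exact hp2.trans (by gcongr)
    _ = (1 + 2 * (Cp : ℝ≥0∞)) * (m ^ (1 / 2 : ℝ) * Kc ^ (3 / 2 : ℝ)) * m * D ^ (3 / 4 : ℝ) +
        ENNReal.ofReal (2 * ν) * m * D ^ (1 / 2 : ℝ) := by ring

/-- **Measurability of the slice dissipation in time** on `(0, t)` (the integrand is jointly
continuous on `(0, ∞) × E`; Tonelli). [folklore] -/
theorem aemeasurable_eDissipationSlice (h : LerayTailHyp ν Cp w u p) (t : ℝ) :
    AEMeasurable (eDissipationSlice u) (volume.restrict (Ioo 0 t)) := by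
  have hS : UniqueDiffOn ℝ (Ioi (0 : ℝ)) := isOpen_Ioi.uniqueDiffOn
  have hc : ContinuousOn (fun z : ℝ × E => ENNReal.ofReal (frobeniusNormSq (fderiv ℝ (u z.1) z.2)))
      (Ioo 0 t ×ˢ univ) := by
    refine ENNReal.continuous_ofReal.comp_continuousOn
      (LerayHopfProofs.continuous_frobeniusNormSq.comp_continuousOn ?_)
    exact (h.solution.smooth_velocity.continuousOn_fderiv_slice hS).mono
      (prod_mono Ioo_subset_Ioi_self Subset.rfl)
  have hm : AEMeasurable (fun z : ℝ × E => ENNReal.ofReal (frobeniusNormSq (fderiv ℝ (u z.1) z.2)))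
      ((volume.restrict (Ioo 0 t)).prod volume) := by
    rw [Measure.restrict_prod_eq_prod_univ, ← Measure.volume_eq_prod]
    exact hc.aemeasurable (measurableSet_Ioo.prod MeasurableSet.univ)
  exact hm.lintegral_prod_right'

/-- **The time-integrated flux bound**: for `0 ≤ t`,
`∫₀ᵗ |X(r)| dr ≤ G (A₁ (M²/(2ν))^{3/4} t^{1/4} + A₂ (M²/(2ν))^{1/2} t^{1/2})` (Hölder in time and the
dissipation bound `∫₀ᵗ∫|Du|² ≤ M²/(2ν)`; Ożański–Pooley 2018, proof of Lemma 6.34, the bounds for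
`I₁, I₂, I₃`). [cite: OzanskiPooley2018, Lemma 6.34 (proof)] -/
theorem lintegral_enorm_tailFlux_le (h : LerayTailHyp ν Cp w u p) (hE : Module.finrank ℝ E = 3)
    (hν : 0 < ν) {M : ℝ} (hM0 : 0 ≤ M) (hM : eLpNorm (u 0) 2 volume ≤ ENNReal.ofReal M)
    {G : ℝ} (hG : 0 ≤ G) {θ : E → ℝ} (hθ : ∀ x, ‖fderiv ℝ θ x‖ ≤ G) {t : ℝ} (ht : 0 ≤ t) :
    ∫⁻ r in Ioo 0 t, ‖tailFlux ν θ (u r) (w r) (p r)‖ₑ ≤ ENNReal.ofReal G *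
      (tailCoeffA Cp (sobolevSixConst E) M *
          (ENNReal.ofReal (M ^ 2 / (2 * ν)) ^ (3 / 4 : ℝ) * ENNReal.ofReal t ^ (1 / 4 : ℝ)) +
        tailCoeffB ν M *
          (ENNReal.ofReal (M ^ 2 / (2 * ν)) ^ (1 / 2 : ℝ) * ENNReal.ofReal t ^ (1 / 2 : ℝ))) := by
  set D := eDissipationSlice u
  have hDm : AEMeasurable D (volume.restrict (Ioo 0 t)) := h.aemeasurable_eDissipationSlice t
  have hDle : ∫⁻ r in Ioo 0 t, D r ≤ ENNReal.ofReal (M ^ 2 / (2 * ν)) :=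
    h.lintegral_eDissipationSlice_le hν ht hM0 hM
  set A₁ := tailCoeffA Cp (sobolevSixConst E) M
  set A₂ := tailCoeffB ν M
  calc ∫⁻ r in Ioo 0 t, ‖tailFlux ν θ (u r) (w r) (p r)‖ₑ
      ≤ ∫⁻ r in Ioo 0 t, ENNReal.ofReal G * (A₁ * D r ^ (3 / 4 : ℝ) + A₂ * D r ^ (1 / 2 : ℝ)) :=
        setLIntegral_mono' measurableSet_Ioo fun r hr =>
          h.enorm_tailFlux_slice_le hE hν hM hG hθ hr.1
    _ = ENNReal.ofReal G * (A₁ * (∫⁻ r in Ioo 0 t, D r ^ (3 / 4 : ℝ)) +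
          A₂ * (∫⁻ r in Ioo 0 t, D r ^ (1 / 2 : ℝ))) := by
        rw [lintegral_const_mul' _ _ ENNReal.ofReal_ne_top,
          lintegral_add_left' ((hDm.pow_const _).const_mul _),
          lintegral_const_mul'' _ (hDm.pow_const _), lintegral_const_mul'' _ (hDm.pow_const _)]
    _ ≤ ENNReal.ofReal G * (A₁ * ((∫⁻ r in Ioo 0 t, D r) ^ (3 / 4 : ℝ) * ENNReal.ofReal t ^ (1 / 4 : ℝ)) +
          A₂ * ((∫⁻ r in Ioo 0 t, D r) ^ (1 / 2 : ℝ) * ENNReal.ofReal t ^ (1 / 2 : ℝ))) := by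
        gcongr
        · exact lintegral_Ioo_rpow_three_quarters_le hDm
        · exact lintegral_Ioo_rpow_half_le hDm
    _ ≤ _ := by gcongr

end LerayTailHyp

end Three


/-! ### The main inequality between two positive times -/

section Main

variable {E : Type*} [NormedAddCommGroup E] [InnerProductSpace ℝ E] [FiniteDimensional ℝ E]
  [MeasurableSpace E] [BorelSpace E]

namespace LerayTailHyp

variable {ν : ℝ} {Cp : ℝ≥0} {w u : ℝ → E → E} {p : ℝ → E → ℝ}

/-- **Continuity in time of the flux** `r ↦ X(r)` on `(0, ∞)` for a `C¹` compactly supported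
cutoff (the integrands are jointly continuous and supported in `tsupport θ`). [folklore] -/
theorem continuousOn_tailFlux (h : LerayTailHyp ν Cp w u p) {θ : E → ℝ} (hθ : ContDiff ℝ 1 θ)
    (hθc : HasCompactSupport θ) :
    ContinuousOn (fun r => tailFlux ν θ (u r) (w r) (p r)) (Ioi 0) := by
  have hS : UniqueDiffOn ℝ (Ioi (0 : ℝ)) := isOpen_Ioi.uniqueDiffOn
  have hU : ContinuousOn (uncurry u) (Ioi 0 ×ˢ univ) := h.solution.smooth_velocity.continuousOn
  have hW : ContinuousOn (uncurry w) (Ioi 0 ×ˢ univ) := h.solution.smooth_drift.continuousOn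
  have hP : ContinuousOn (uncurry p) (Ioi 0 ×ˢ univ) := h.solution.smooth_pressure.continuousOn
  have hDU : ContinuousOn (fun z : ℝ × E => fderiv ℝ (u z.1) z.2) (Ioi 0 ×ˢ univ) :=
    h.solution.smooth_velocity.continuousOn_fderiv_slice hS
  have hg : Continuous (gradient θ) := continuous_gradient_of_contDiff hθ
  have hg2 : ContinuousOn (fun z : ℝ × E => gradient θ z.2) (Ioi 0 ×ˢ univ) :=
    (hg.comp continuous_snd).continuousOn
  have hK : IsCompact (tsupport θ) := hθc
  have hg0 : ∀ x ∉ tsupport θ, gradient θ x = 0 := fun x hx => gradient_eq_zero_of_notMem_tsupport hx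
  -- the three terms
  have hA : ContinuousOn (fun r => ∫ x, ‖u r x‖ ^ 2 * ⟪w r x, gradient θ x⟫) (Ioi 0) := by
    refine continuousOn_integral_of_compact_support hK ?_ fun r x _ hx => by simp [hg0 x hx]
    exact (hU.norm.pow 2).mul (hW.inner hg2)
  have hDUg : ContinuousOn (fun z : ℝ × E => fderiv ℝ (u z.1) z.2 (gradient θ z.2)) (Ioi 0 ×ˢ univ) :=
    (isBoundedBilinearMap_apply (𝕜 := ℝ) (E := E) (F := E)).continuous.comp_continuousOn
      (hDU.prodMk hg2)
  have hB : ContinuousOn (fun r => ∫ x, ⟪fderiv ℝ (u r) x (gradient θ x), u r x⟫) (Ioi 0) := by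
    refine continuousOn_integral_of_compact_support hK ?_ fun r x _ hx => by simp [hg0 x hx]
    exact hDUg.inner hU
  have hC : ContinuousOn (fun r => ∫ x, p r x * ⟪u r x, gradient θ x⟫) (Ioi 0) := by
    refine continuousOn_integral_of_compact_support hK ?_ fun r x _ hx => by simp [hg0 x hx]
    exact hP.mul (hU.inner hg2)
  simp only [tailFlux_def]
  exact (hA.sub (continuousOn_const.mul hB)).add (continuousOn_const.mul hC)

/-- Continuity in time of the weighted dissipation `r ↦ ∫ θ |Du(r)|²_F` on `(0, ∞)` for a
continuous compactly supported weight. [folklore] -/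
theorem continuousOn_weightedDissipation (h : LerayTailHyp ν Cp w u p) {θ : E → ℝ}
    (hθ : Continuous θ) (hθc : HasCompactSupport θ) :
    ContinuousOn (fun r => ∫ x, θ x * frobeniusNormSq (fderiv ℝ (u r) x)) (Ioi 0) := by
  have hS : UniqueDiffOn ℝ (Ioi (0 : ℝ)) := isOpen_Ioi.uniqueDiffOn
  have hDU : ContinuousOn (fun z : ℝ × E => fderiv ℝ (u z.1) z.2) (Ioi 0 ×ˢ univ) :=
    h.solution.smooth_velocity.continuousOn_fderiv_slice hS
  refine continuousOn_integral_of_compact_support (k := tsupport θ) hθc ?_ fun r x _ hx => by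
    simp [image_eq_zero_of_notMem_tsupport hx]
  exact ((hθ.comp continuous_snd).continuousOn.mul
    (LerayHopfProofs.continuous_frobeniusNormSq.comp_continuousOn hDU) : _)

/-- The weighted dissipation over `(s, t)` is dominated by the dissipation:
`0 ≤ ∫ₛᵗ∫ θ|Du|² ≤ (∫ₛᵗ∫|Du|²_F)` for `0 ≤ θ ≤ 1`, `0 < s`. [folklore] -/
theorem integral_weightedDissipation_le (h : LerayTailHyp ν Cp w u p) {θ : E → ℝ}
    (hθ : Continuous θ) (hθc : HasCompactSupport θ) (hθ0 : ∀ x, 0 ≤ θ x) (hθ1 : ∀ x, θ x ≤ 1)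
    {s : ℝ} (t : ℝ) (hs : 0 < s) :
    0 ≤ ∫ r in Ioo s t, ∫ x, θ x * frobeniusNormSq (fderiv ℝ (u r) x) ∧
    ENNReal.ofReal (∫ r in Ioo s t, ∫ x, θ x * frobeniusNormSq (fderiv ℝ (u r) x)) ≤
      ∫⁻ r in Ioo s t, eDissipationSlice u r := by
  set Y : ℝ → ℝ := fun r => ∫ x, θ x * frobeniusNormSq (fderiv ℝ (u r) x)
  have hY0 : ∀ r, 0 ≤ Y r := fun r =>
    integral_nonneg fun x => mul_nonneg (hθ0 x) (frobeniusNormSq_nonneg _)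
  have hYc : ContinuousOn Y (Icc s t) :=
    (h.continuousOn_weightedDissipation hθ hθc).mono fun r hr => hs.trans_le hr.1
  have hYi : IntegrableOn Y (Ioo s t) volume :=
    (hYc.integrableOn_compact isCompact_Icc).mono_set Ioo_subset_Icc_self
  refine ⟨setIntegral_nonneg measurableSet_Ioo fun r _ => hY0 r, ?_⟩
  rw [ofReal_integral_eq_lintegral_ofReal hYi (ae_of_all _ fun r => hY0 r)]
  refine setLIntegral_mono' measurableSet_Ioo fun r hr => ?_
  have hr0 : 0 < r := hs.trans hr.1
  have hcont : Continuous fun x => θ x * frobeniusNormSq (fderiv ℝ (u r) x) :=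
    hθ.mul (LerayHopfProofs.continuous_frobeniusNormSq.comp
      (((h.solution.smooth_velocity.contDiff_slice hr0).of_le (by norm_cast) :
        ContDiff ℝ 1 (u r)).continuous_fderiv one_ne_zero))
  have hint : Integrable (fun x => θ x * frobeniusNormSq (fderiv ℝ (u r) x)) volume :=
    hcont.integrable_of_hasCompactSupport hθc.mul_right
  change ENNReal.ofReal (∫ x, θ x * frobeniusNormSq (fderiv ℝ (u r) x)) ≤ eDissipationSlice u r
  rw [ofReal_integral_eq_lintegral_ofReal hint
    (ae_of_all _ fun x => mul_nonneg (hθ0 x) (frobeniusNormSq_nonneg _)), eDissipationSlice_apply]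
  refine lintegral_mono fun x => ENNReal.ofReal_le_ofReal ?_
  have := frobeniusNormSq_nonneg (fderiv ℝ (u r) x)
  nlinarith [hθ1 x, hθ0 x]

/-- **The main inequality between two positive times.** For a cutoff `θ ∈ C^∞_c` with
`0 ≤ θ ≤ 1` and `0 < s ≤ t`, if the flux is absolutely integrable on `(0, t)` then
`∫ (1 − θ)|u(t)|² ≤ ∫ (1 − θ)|u(s)|² + ∫₀ᵗ |X(r)| dr`: the local energy identity for `θ` on
`[s, t]` subtracted from the global energy inequality on `[s, t]`, discarding
`2ν ∫ₛᵗ∫ (1 − θ)|Du|² ≥ 0` (Leray 1934, §27, (5.3) ⇒ (5.4); Ożański–Pooley 2018, proof of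
Lemma 6.34: "Bounding below the second term … and using the nonnegativity of the first term"). [cite: OzanskiPooley2018, Lemma 6.34 (proof)] -/
theorem integral_one_sub_mul_norm_sq_le (h : LerayTailHyp ν Cp w u p) (hν : 0 ≤ ν) {θ : E → ℝ}
    (hθ : ContDiff ℝ 2 θ) (hθc : HasCompactSupport θ) (hθ0 : ∀ x, 0 ≤ θ x) (hθ1 : ∀ x, θ x ≤ 1)
    {s t : ℝ} (hs : 0 < s) (hst : s ≤ t)
    (hfin : ∫⁻ r in Ioo 0 t, ‖tailFlux ν θ (u r) (w r) (p r)‖ₑ < ⊤) :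
    ∫ x, (1 - θ x) * ‖u t x‖ ^ 2 ≤ (∫ x, (1 - θ x) * ‖u s x‖ ^ 2) +
      (∫⁻ r in Ioo 0 t, ‖tailFlux ν θ (u r) (w r) (p r)‖ₑ).toReal := by
  have ht : 0 < t := hs.trans_le hst
  have hI : Icc s t ⊆ Ioi 0 := fun r hr => hs.trans_le hr.1
  set X : ℝ → ℝ := fun r => tailFlux ν θ (u r) (w r) (p r) with hXdef
  set Y : ℝ → ℝ := fun r => ∫ x, θ x * frobeniusNormSq (fderiv ℝ (u r) x) with hYdef
  set Be := ∫⁻ r in Ioo 0 t, ‖X r‖ₑ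
  -- (i) the local energy identity on `[s, t]`
  have hloc := h.solution.local_energy_identity (stdOrthonormalBasis ℝ E) isOpen_Ioi hθ hθc hst hI
  have hloc' : (∫ x, θ x * ‖u t x‖ ^ 2) - (∫ x, θ x * ‖u s x‖ ^ 2) =
      ∫ r in Ioo s t, (X r - 2 * ν * Y r) := by
    rw [hloc]
    refine setIntegral_congr_fun measurableSet_Ioo fun r _ => ?_
    simp only [hXdef, hYdef, tailFlux_def]
    ring
  -- (ii) integrability of `X` and `Y` on `(s, t)`
  have hXc : ContinuousOn X (Icc s t) :=
    (h.continuousOn_tailFlux (hθ.of_le one_le_two) hθc).mono hI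
  have hXi : IntegrableOn X (Ioo s t) volume :=
    (hXc.integrableOn_compact isCompact_Icc).mono_set Ioo_subset_Icc_self
  have hYc : ContinuousOn Y (Icc s t) :=
    (h.continuousOn_weightedDissipation hθ.continuous hθc).mono hI
  have hYi : IntegrableOn Y (Ioo s t) volume :=
    (hYc.integrableOn_compact isCompact_Icc).mono_set Ioo_subset_Icc_self
  have hsplit : ∫ r in Ioo s t, (X r - 2 * ν * Y r) =
      (∫ r in Ioo s t, X r) - 2 * ν * ∫ r in Ioo s t, Y r := by
    rw [integral_sub hXi (hYi.const_mul _), integral_const_mul]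
  -- (iii) the weighted dissipation is dominated by the dissipation
  set Dst := ∫⁻ r in Ioo s t, eDissipationSlice u r
  have hDst_fin : Dst ≠ ⊤ :=
    ((lintegral_mono_set (Ioo_subset_Ioo hs.le le_rfl)).trans_lt (h.dissipation_lt_top t)).ne
  obtain ⟨hY0, hYle⟩ := h.integral_weightedDissipation_le hθ.continuous hθc hθ0 hθ1 t hs
  have hYle' : ∫ r in Ioo s t, Y r ≤ Dst.toReal := (ENNReal.ofReal_le_iff_le_toReal hDst_fin).1 hYle
  -- (iv) the flux integral is bounded by `Be`
  have hXle : |∫ r in Ioo s t, X r| ≤ Be.toReal := by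
    rw [← ENNReal.ofReal_le_iff_le_toReal hfin.ne, ← Real.enorm_eq_ofReal_abs]
    exact (enorm_integral_le_lintegral_enorm _).trans (lintegral_mono_set (Ioo_subset_Ioo hs.le le_rfl))
  -- (v) the energy inequality on `[s, t]`
  have hen := h.energy_le s t hs.le hst
  simp only [VectorCalculus.kineticEnergy] at hen
  -- (vi) `∫ (1 − θ)|u r|² = ∫ |u r|² − ∫ θ|u r|²`
  have hsplit2 : ∀ {r : ℝ}, 0 < r →
      ∫ x, (1 - θ x) * ‖u r x‖ ^ 2 = (∫ x, ‖u r x‖ ^ 2) - ∫ x, θ x * ‖u r x‖ ^ 2 := by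
    intro r hr
    have h1 : Integrable (fun x => ‖u r x‖ ^ 2) volume := (h.memLp hr.le).integrable_norm_pow two_ne_zero
    have h2 : Integrable (fun x => θ x * ‖u r x‖ ^ 2) volume :=
      (hθ.continuous.mul ((h.solution.smooth_velocity.contDiff_slice hr).continuous.norm.pow 2)
        ).integrable_of_hasCompactSupport hθc.mul_right
    rw [← integral_sub h1 h2]
    refine integral_congr_ae (ae_of_all _ fun x => ?_)
    ring
  rw [hsplit2 ht, hsplit2 hs]
  have hνY : 0 ≤ ν * (Dst.toReal - ∫ r in Ioo s t, Y r) := mul_nonneg hν (sub_nonneg.2 hYle')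
  have hX' := (abs_le.1 hXle).1
  rw [hsplit] at hloc'
  nlinarith

end LerayTailHyp

end Main


/-! ### Passage to `s → 0⁺` and the separation of energy -/

section Final

variable {E : Type*} [NormedAddCommGroup E] [InnerProductSpace ℝ E] [FiniteDimensional ℝ E]
  [MeasurableSpace E] [BorelSpace E]

namespace LerayTailHyp

variable {ν : ℝ} {Cp : ℝ≥0} {w u : ℝ → E → E} {p : ℝ → E → ℝ}

/-- Pointwise: `|(1 − θ)(|a|² − |b|²)| ≤ |a − b| (|a| + |b|)` for `0 ≤ θ ≤ 1`, in `ℝ≥0∞`. [folklore] -/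
theorem enorm_one_sub_mul_sub_le {F : Type*} [NormedAddCommGroup F] {θ : ℝ} (hθ0 : 0 ≤ θ)
    (hθ1 : θ ≤ 1) (a b : F) :
    ‖(1 - θ) * (‖a‖ ^ 2 - ‖b‖ ^ 2)‖ₑ ≤ ‖a - b‖ₑ * (‖a‖ₑ + ‖b‖ₑ) := by
  rw [Real.enorm_eq_ofReal_abs, ← ofReal_norm, ← ofReal_norm, ← ofReal_norm,
    ← ENNReal.ofReal_add (norm_nonneg _) (norm_nonneg _), ← ENNReal.ofReal_mul (norm_nonneg _)]
  refine ENNReal.ofReal_le_ofReal ?_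
  rw [abs_mul]
  have h1 : |1 - θ| ≤ 1 := by rw [abs_le]; constructor <;> linarith
  have h2 : |‖a‖ ^ 2 - ‖b‖ ^ 2| ≤ ‖a - b‖ * (‖a‖ + ‖b‖) := by
    rw [sq_sub_sq, abs_mul, abs_of_nonneg (by positivity : 0 ≤ ‖a‖ + ‖b‖), mul_comm]
    gcongr
    exact abs_norm_sub_norm_le a b
  calc |1 - θ| * |‖a‖ ^ 2 - ‖b‖ ^ 2| ≤ 1 * (‖a - b‖ * (‖a‖ + ‖b‖)) := by gcongr
    _ = ‖a - b‖ * (‖a‖ + ‖b‖) := one_mul _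

/-- **Continuity of the exterior energy at `t = 0⁺`**: for a continuous weight `0 ≤ θ ≤ 1`,
`∫ (1 − θ)|u(r)|² → ∫ (1 − θ)|u(0)|²` as `r → 0⁺` (from `u ∈ C([0, ∞); L²)`:
`|∫(1 − θ)(|u(r)|² − |u(0)|²)| ≤ ‖u(r) − u(0)‖₂ (‖u(r)‖₂ + ‖u(0)‖₂)`). [folklore] -/
theorem tendsto_integral_one_sub_mul_norm_sq (h : LerayTailHyp ν Cp w u p) (hν : 0 ≤ ν)
    {θ : E → ℝ} (hθ : Continuous θ) (hθ0 : ∀ x, 0 ≤ θ x) (hθ1 : ∀ x, θ x ≤ 1) :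
    Tendsto (fun r => ∫ x, (1 - θ x) * ‖u r x‖ ^ 2) (𝓝[>] 0)
      (𝓝 (∫ x, (1 - θ x) * ‖u 0 x‖ ^ 2)) := by
  set g : ℝ → ℝ := fun r => ∫ x, (1 - θ x) * ‖u r x‖ ^ 2 with hg
  set e : ℝ → ℝ≥0∞ := fun r => eLpNorm (u r - u 0) 2 volume with he
  set C : ℝ≥0∞ := 2 * eLpNorm (u 0) 2 volume with hC
  have hCtop : C ≠ ⊤ := ENNReal.mul_ne_top (by norm_num) (h.memLp le_rfl).eLpNorm_ne_top
  have hθm : AEStronglyMeasurable (fun x => 1 - θ x) volume :=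
    (continuous_const.sub hθ).aestronglyMeasurable
  have hint : ∀ {r : ℝ}, 0 ≤ r → Integrable (fun x => (1 - θ x) * ‖u r x‖ ^ 2) volume := by
    intro r hr
    refine ((h.memLp hr).integrable_norm_pow two_ne_zero).bdd_mul hθm (c := 1)
      (ae_of_all _ fun x => ?_)
    rw [Real.norm_eq_abs, abs_le]; constructor <;> linarith [hθ0 x, hθ1 x]
  -- the key estimate
  have hkey : ∀ {r : ℝ}, 0 ≤ r → ‖g r - g 0‖ₑ ≤ e r * C := by
    intro r hr
    have hum : AEStronglyMeasurable (u r) volume := (h.memLp hr).1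
    have hu0m : AEStronglyMeasurable (u 0) volume := (h.memLp le_rfl).1
    have hdm : AEStronglyMeasurable (u r - u 0) volume := hum.sub hu0m
    have hsub : g r - g 0 = ∫ x, (1 - θ x) * (‖u r x‖ ^ 2 - ‖u 0 x‖ ^ 2) := by
      simp only [hg]
      rw [← integral_sub (hint hr) (hint le_rfl)]
      refine integral_congr_ae (ae_of_all _ fun x => ?_)
      ring
    rw [hsub]
    calc ‖∫ x, (1 - θ x) * (‖u r x‖ ^ 2 - ‖u 0 x‖ ^ 2)‖ₑ
        ≤ ∫⁻ x, ‖(1 - θ x) * (‖u r x‖ ^ 2 - ‖u 0 x‖ ^ 2)‖ₑ := enorm_integral_le_lintegral_enorm _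
      _ ≤ ∫⁻ x, ‖(u r - u 0) x‖ₑ * ‖u r x‖ₑ + ‖(u r - u 0) x‖ₑ * ‖u 0 x‖ₑ :=
          lintegral_mono fun x => (enorm_one_sub_mul_sub_le (hθ0 x) (hθ1 x) _ _).trans_eq
            (by rw [Pi.sub_apply, mul_add])
      _ = (∫⁻ x, ‖(u r - u 0) x‖ₑ * ‖u r x‖ₑ) + ∫⁻ x, ‖(u r - u 0) x‖ₑ * ‖u 0 x‖ₑ :=
          lintegral_add_left' (hdm.enorm.mul hum.enorm) _
      _ ≤ e r * eLpNorm (u r) 2 volume + e r * eLpNorm (u 0) 2 volume :=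
          add_le_add (lintegral_enorm_mul_enorm_le hdm hum) (lintegral_enorm_mul_enorm_le hdm hu0m)
      _ ≤ e r * eLpNorm (u 0) 2 volume + e r * eLpNorm (u 0) 2 volume := by
          gcongr; exact h.eLpNorm_le hν hr
      _ = e r * C := by rw [hC]; ring
  -- the bound tends to zero
  have he0 : Tendsto e (𝓝[>] 0) (𝓝 0) := by
    have := h.continuousInL2.2 0 (mem_Ici.2 le_rfl)
    exact this.mono_left (nhdsWithin_mono _ Ioi_subset_Ici_self)
  have hb0 : Tendsto (fun r => (e r * C).toReal) (𝓝[>] 0) (𝓝 0) := by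
    have h1 : Tendsto (fun r => e r * C) (𝓝[>] 0) (𝓝 (0 * C)) :=
      ENNReal.Tendsto.mul_const he0 (Or.inr hCtop)
    rw [zero_mul] at h1
    have h2 := (ENNReal.tendsto_toReal ENNReal.zero_ne_top).comp h1
    rwa [ENNReal.toReal_zero] at h2
  rw [tendsto_iff_norm_sub_tendsto_zero]
  refine squeeze_zero' (Eventually.of_forall fun r => norm_nonneg _) ?_ hb0
  filter_upwards [self_mem_nhdsWithin] with r hr
  have hr' : 0 ≤ r := le_of_lt hr
  have hfin : e r * C ≠ ⊤ := ENNReal.mul_ne_top ((h.memLp hr').sub (h.memLp le_rfl)).eLpNorm_ne_top hCtop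
  rw [← ENNReal.ofReal_le_iff_le_toReal hfin, ofReal_norm]
  exact hkey hr'

end LerayTailHyp

/-- **The tail constant** `C̄(M, t)` of the separation of energy, before the absolute factor
coming from the cutoff: `C̄ = (1 + 2C_p) M^{1/2} K^{3/2} M · (M²/(2ν))^{3/4} t^{1/4} +
2νM · (M²/(2ν))^{1/2} t^{1/2}`, i.e. `C (M³ t^{1/4} + M² t^{1/2})` with `C` depending on
`ν, C_p, K` only — Leray's `A ν^{-1/4} W^{3/2} t^{1/4} + A' W √(νt)` form of (5.7) / Ożański–Pooley's
`C(u₀, t) = C‖u₀‖²√t + C‖u₀‖³t^{1/4}` (for `ν = 1`), with `M = ‖u₀‖`. [cite: OzanskiPooley2018, Lemma 6.34] -/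
def lerayTailBound (ν : ℝ) (Cp K : ℝ≥0) (M t : ℝ) : ℝ :=
  ((1 + 2 * (Cp : ℝ)) * (M ^ (1 / 2 : ℝ) * (K : ℝ) ^ (3 / 2 : ℝ)) * M) *
      ((M ^ 2 / (2 * ν)) ^ (3 / 4 : ℝ) * t ^ (1 / 4 : ℝ)) +
    (2 * ν * M) * ((M ^ 2 / (2 * ν)) ^ (1 / 2 : ℝ) * t ^ (1 / 2 : ℝ))

/-- `C̄(M, t) ≥ 0` for `ν, M, t ≥ 0`. [folklore] -/
theorem lerayTailBound_nonneg {ν : ℝ} (hν : 0 ≤ ν) (Cp K : ℝ≥0) {M t : ℝ} (hM : 0 ≤ M) (ht : 0 ≤ t) :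
    0 ≤ lerayTailBound ν Cp K M t := by
  unfold lerayTailBound
  positivity

/-- **The explicit form of the tail constant**: for `M ≥ 0`, `ν > 0`,
`C̄(M, t) = (1 + 2C_p) K^{3/2} (2ν)^{-3/4} · M³ t^{1/4} + (2ν)^{1/2} · M² t^{1/2}` — Leray's (5.7)
`A W^{3/2}… t^{1/4}`/`√(νt)` terms, Ożański–Pooley's `C‖u₀‖³t^{1/4} + C‖u₀‖²√t`. [cite: OzanskiPooley2018, Lemma 6.34] -/
theorem lerayTailBound_eq {ν : ℝ} (hν : 0 < ν) (Cp K : ℝ≥0) {M : ℝ} (hM : 0 ≤ M) (t : ℝ) :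
    lerayTailBound ν Cp K M t =
      (1 + 2 * (Cp : ℝ)) * (K : ℝ) ^ (3 / 2 : ℝ) * (2 * ν) ^ (-(3 / 4 : ℝ)) * (M ^ 3 * t ^ (1 / 4 : ℝ)) +
        (2 * ν) ^ (1 / 2 : ℝ) * (M ^ 2 * t ^ (1 / 2 : ℝ)) := by
  unfold lerayTailBound
  set a := Real.sqrt M with ha
  have ha0 : 0 ≤ a := Real.sqrt_nonneg M
  have h1 : M ^ (1 / 2 : ℝ) = a := by rw [ha, Real.sqrt_eq_rpow]
  have h2 : M = a ^ 2 := (Real.sq_sqrt hM).symm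
  set b := (2 * ν) ^ (1 / 4 : ℝ) with hb
  have hb0 : 0 < b := Real.rpow_pos_of_pos (by positivity) _
  have h3 : 2 * ν = b ^ 4 := by
    rw [hb, ← Real.rpow_natCast, ← Real.rpow_mul (by positivity)]; norm_num
  rw [h1, h2, h3]
  have hab : 0 ≤ a / b := div_nonneg ha0 hb0.le
  have e1 : ((a ^ 2) ^ 2 / b ^ 4) ^ (3 / 4 : ℝ) = (a / b) ^ 3 := by
    rw [show (a ^ 2) ^ 2 / b ^ 4 = (a / b) ^ 4 by ring, ← Real.rpow_natCast (a / b) 4,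
      ← Real.rpow_mul hab]
    norm_num
  have e2 : ((a ^ 2) ^ 2 / b ^ 4) ^ (1 / 2 : ℝ) = (a / b) ^ 2 := by
    rw [show (a ^ 2) ^ 2 / b ^ 4 = (a / b) ^ 4 by ring, ← Real.rpow_natCast (a / b) 4,
      ← Real.rpow_mul hab]
    norm_num
  have e3 : (b ^ 4) ^ (-(3 / 4 : ℝ)) = (b ^ 3)⁻¹ := by
    rw [← Real.rpow_natCast b 4, ← Real.rpow_mul hb0.le, ← Real.rpow_natCast b 3,
      ← Real.rpow_neg hb0.le]
    norm_num
  have e4 : (b ^ 4) ^ (1 / 2 : ℝ) = b ^ 2 := by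
    rw [← Real.rpow_natCast b 4, ← Real.rpow_mul hb0.le]
    norm_num
  rw [e1, e2, e3, e4]
  field_simp

/-- `C̄(M, t) ≤ C'(M³t^{1/4} + M²t^{1/2})` with
`C' = max ((1 + 2C_p)K^{3/2}(2ν)^{-3/4}) ((2ν)^{1/2})`. [folklore] -/
theorem lerayTailBound_le {ν : ℝ} (hν : 0 < ν) (Cp K : ℝ≥0) {M t : ℝ} (hM : 0 ≤ M) (ht : 0 ≤ t) :
    lerayTailBound ν Cp K M t ≤
      max ((1 + 2 * (Cp : ℝ)) * (K : ℝ) ^ (3 / 2 : ℝ) * (2 * ν) ^ (-(3 / 4 : ℝ))) ((2 * ν) ^ (1 / 2 : ℝ)) *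
        (M ^ 3 * t ^ (1 / 4 : ℝ) + M ^ 2 * t ^ (1 / 2 : ℝ)) := by
  rw [lerayTailBound_eq hν Cp K hM t, mul_add]
  gcongr
  · exact le_max_left _ _
  · exact le_max_right _ _

/-- `A₁ = ofReal ((1 + 2C_p) M^{1/2} K^{3/2} M)`. [folklore] -/
theorem tailCoeffA_eq_ofReal (Cp K : ℝ≥0) {M : ℝ} (hM : 0 ≤ M) :
    tailCoeffA Cp K M = ENNReal.ofReal ((1 + 2 * (Cp : ℝ)) * (M ^ (1 / 2 : ℝ) * (K : ℝ) ^ (3 / 2 : ℝ)) * M) := by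
  have hK : ENNReal.ofReal ((K : ℝ) ^ (3 / 2 : ℝ)) = (K : ℝ≥0∞) ^ (3 / 2 : ℝ) := by
    rw [← NNReal.coe_rpow, ENNReal.ofReal_coe_nnreal, ENNReal.coe_rpow_of_nonneg _ (by norm_num)]
  unfold tailCoeffA
  simp (disch := positivity) only [ENNReal.ofReal_mul, ENNReal.ofReal_add, ENNReal.ofReal_one,
    ENNReal.ofReal_ofNat, ENNReal.ofReal_coe_nnreal, hK, ENNReal.ofReal_rpow_of_nonneg hM]

/-- `A₂ = ofReal (2νM)`. [folklore] -/
theorem tailCoeffB_eq_ofReal {ν : ℝ} (hν : 0 ≤ ν) (M : ℝ) :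
    tailCoeffB ν M = ENNReal.ofReal (2 * ν * M) := by
  unfold tailCoeffB
  rw [← ENNReal.ofReal_mul (by positivity)]

/-- The extended-real majorant of the time-integrated flux is `ofReal (G · C̄(M, t))`. [folklore] -/
theorem ofReal_mul_lerayTailBound {ν : ℝ} (hν : 0 < ν) (Cp K : ℝ≥0) {M t G : ℝ} (hM : 0 ≤ M)
    (ht : 0 ≤ t) (hG : 0 ≤ G) :
    ENNReal.ofReal G *
        (tailCoeffA Cp K M * (ENNReal.ofReal (M ^ 2 / (2 * ν)) ^ (3 / 4 : ℝ) * ENNReal.ofReal t ^ (1 / 4 : ℝ)) +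
          tailCoeffB ν M * (ENNReal.ofReal (M ^ 2 / (2 * ν)) ^ (1 / 2 : ℝ) * ENNReal.ofReal t ^ (1 / 2 : ℝ))) =
      ENNReal.ofReal (G * lerayTailBound ν Cp K M t) := by
  have hD : 0 ≤ M ^ 2 / (2 * ν) := by positivity
  rw [tailCoeffA_eq_ofReal Cp K hM, tailCoeffB_eq_ofReal hν.le, lerayTailBound,
    ENNReal.ofReal_rpow_of_nonneg hD (by norm_num), ENNReal.ofReal_rpow_of_nonneg hD (by norm_num),
    ENNReal.ofReal_rpow_of_nonneg ht (by norm_num), ENNReal.ofReal_rpow_of_nonneg ht (by norm_num)]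
  simp (disch := positivity) only [← ENNReal.ofReal_mul, ← ENNReal.ofReal_add]

/-- **Leray's separation of energy** (Leray 1934, Ch. V §27, (5.2)–(5.7); Ożański–Pooley 2018,
Lemma 6.34; Robinson–Rodrigo–Sadowski 2016, Prop. 14.3 on `𝕋³`-free form). Let `dim E = 3`, `ν > 0`,
`C_p ≥ 0`. There is an absolute constant `C ≥ 0` such that for every finite-energy classical solution
`(w, u, p)` of the drift system `∂ₜu + (w·∇)u = νΔu − ∇p`, `div u = div w = 0` on `(0, ∞)` in the
sense of `LerayTailHyp ν C_p` (for Leray's regularised system: `w = J_εu`) and every `M ≥ ‖u(0)‖₂`: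
for `0 < R₁ < R₂` and `t ≥ 0`,

  `∫_{|x|>R₂} |u(t)|² ≤ ∫_{|x|>R₁} |u(0)|² + C · C̄(M, t)/(R₂ − R₁)`,

`C̄ = lerayTailBound ν C_p K M t = C'(M³t^{1/4} + M²t^{1/2})` (`K` the Sobolev constant of
`H¹ ⊂ L⁶`), uniformly in the solution — in particular uniformly in `ε` for the regularised
problems, which is the point of Leray's §27 ("Ces résultats devront être indépendants de `ε`").
Proof: the local energy identity for the radial cutoff `θ_{R₁,R₂}` subtracted from the energy
inequality, the flux bounded slice-wise by `|∇θ| ≤ C/(R₂ − R₁)`, Cauchy–Schwarz, `‖p‖₂ ≤ C_p‖u‖₄²`,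
`‖u‖₄² ≤ ‖u‖₂^{1/2}(K‖Du‖₂)^{3/2}`, `‖u(r)‖₂ ≤ M`, Hölder in time with `∫₀ᵗ‖Du‖₂² ≤ M²/(2ν)`, and
`s → 0⁺` by `L²`-continuity. [cite: Leray1934, Ch. V §27 (5.2)–(5.7)] -/
theorem exists_leray_separation_of_energy (hE : Module.finrank ℝ E = 3) {ν : ℝ} (hν : 0 < ν)
    (Cp : ℝ≥0) :
    ∃ C : ℝ, 0 ≤ C ∧ ∀ ⦃w u : ℝ → E → E⦄ ⦃p : ℝ → E → ℝ⦄, LerayTailHyp ν Cp w u p →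
      ∀ ⦃M : ℝ⦄, 0 ≤ M → eLpNorm (u 0) 2 volume ≤ ENNReal.ofReal M →
      ∀ (R₁ R₂ t : ℝ), 0 < R₁ → R₁ < R₂ → 0 ≤ t →
        ∫⁻ x in {x | R₂ < ‖x‖}, ‖u t x‖ₑ ^ 2 ≤
          (∫⁻ x in {x | R₁ < ‖x‖}, ‖u 0 x‖ₑ ^ 2) +
            ENNReal.ofReal (C * lerayTailBound ν Cp (sobolevSixConst E) M t / (R₂ - R₁)) := by
  obtain ⟨C₀, hC0, hC⟩ := exists_norm_fderiv_radialCutoff_le_div (E := E)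
  refine ⟨C₀, hC0, fun w u p h M hM0 hM R₁ R₂ t hR₁ hR ht => ?_⟩
  have hmeas : ∀ R : ℝ, MeasurableSet {x : E | R < ‖x‖} := fun R =>
    measurableSet_lt measurable_const measurable_norm
  -- the case `t = 0`
  rcases ht.eq_or_lt with rfl | ht0
  · refine (lintegral_mono_set fun x (hx : R₂ < ‖x‖) => ?_).trans le_self_add
    exact hR.trans hx
  -- the cutoff
  set θ : E → ℝ := radialCutoff R₁ R₂ with hθdef
  have hθs : ContDiff ℝ 2 θ := radialCutoff_contDiff R₁ R₂
  have hθc : HasCompactSupport θ := hasCompactSupport_radialCutoff hR₁.le hR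
  have hθ0 : ∀ x, 0 ≤ θ x := radialCutoff_nonneg R₁ R₂
  have hθ1 : ∀ x, θ x ≤ 1 := radialCutoff_le_one R₁ R₂
  set G : ℝ := C₀ / (R₂ - R₁) with hGdef
  have hG : 0 ≤ G := div_nonneg hC0 (sub_nonneg.2 hR.le)
  have hθG : ∀ x, ‖fderiv ℝ θ x‖ ≤ G := hC hR₁.le hR
  -- the flux bound
  set Be := ∫⁻ r in Ioo 0 t, ‖tailFlux ν θ (u r) (w r) (p r)‖ₑ with hBe
  have hBe_le : Be ≤ ENNReal.ofReal (G * lerayTailBound ν Cp (sobolevSixConst E) M t) := by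
    rw [← ofReal_mul_lerayTailBound hν Cp _ hM0 ht hG]
    exact h.lintegral_enorm_tailFlux_le hE hν hM0 hM hG hθG ht
  have hBe_fin : Be < ⊤ := hBe_le.trans_lt ENNReal.ofReal_lt_top
  -- the main inequality and the limit `s → 0⁺`
  set g : ℝ → ℝ := fun r => ∫ x, (1 - θ x) * ‖u r x‖ ^ 2 with hg
  have hkey : ∀ s ∈ Ioc 0 t, g t ≤ g s + Be.toReal := fun s hs =>
    h.integral_one_sub_mul_norm_sq_le hν.le hθs hθc hθ0 hθ1 hs.1 hs.2 hBe_fin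
  have hlim : g t ≤ g 0 + Be.toReal := by
    have htend := (h.tendsto_integral_one_sub_mul_norm_sq hν.le hθs.continuous hθ0 hθ1).add_const
      Be.toReal
    refine ge_of_tendsto htend ?_
    filter_upwards [Ioc_mem_nhdsGT ht0] with s hs using hkey s hs
  -- integrability and nonnegativity of the weighted energies
  have hθm : AEStronglyMeasurable (fun x => 1 - θ x) volume :=
    (continuous_const.sub hθs.continuous).aestronglyMeasurable
  have hint : ∀ {r : ℝ}, 0 ≤ r → Integrable (fun x => (1 - θ x) * ‖u r x‖ ^ 2) volume := by
    intro r hr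
    refine ((h.memLp hr).integrable_norm_pow two_ne_zero).bdd_mul hθm (c := 1)
      (ae_of_all _ fun x => ?_)
    rw [Real.norm_eq_abs, abs_le]; constructor <;> linarith [hθ0 x, hθ1 x]
  have hnn : ∀ r x, 0 ≤ (1 - θ x) * ‖u r x‖ ^ 2 := fun r x =>
    mul_nonneg (sub_nonneg.2 (hθ1 x)) (sq_nonneg _)
  have hg0 : 0 ≤ g 0 := integral_nonneg (hnn 0)
  -- conversion of the left-hand side
  have hL : ∫⁻ x in {x | R₂ < ‖x‖}, ‖u t x‖ₑ ^ 2 ≤ ENNReal.ofReal (g t) := by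
    rw [hg, ofReal_integral_eq_lintegral_ofReal (hint ht) (ae_of_all _ (hnn t))]
    calc ∫⁻ x in {x | R₂ < ‖x‖}, ‖u t x‖ₑ ^ 2
        = ∫⁻ x in {x | R₂ < ‖x‖}, ENNReal.ofReal ((1 - θ x) * ‖u t x‖ ^ 2) := by
          refine setLIntegral_congr_fun (hmeas R₂) fun x (hx : R₂ < ‖x‖) => ?_
          rw [hθdef, radialCutoff_eq_zero hR₁.le hR hx.le, sub_zero, one_mul,
            ENNReal.ofReal_pow (norm_nonneg _), ofReal_norm]
      _ ≤ ∫⁻ x, ENNReal.ofReal ((1 - θ x) * ‖u t x‖ ^ 2) := setLIntegral_le_lintegral _ _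
  -- conversion of the datum term
  have hR : ENNReal.ofReal (g 0) ≤ ∫⁻ x in {x | R₁ < ‖x‖}, ‖u 0 x‖ₑ ^ 2 := by
    rw [hg, ofReal_integral_eq_lintegral_ofReal (hint le_rfl) (ae_of_all _ (hnn 0)),
      ← lintegral_indicator (hmeas R₁)]
    refine lintegral_mono fun x => ?_
    by_cases hx : R₁ < ‖x‖
    · rw [indicator_of_mem (show x ∈ {x : E | R₁ < ‖x‖} from hx), ← ofReal_norm,
        ← ENNReal.ofReal_pow (norm_nonneg _)]
      refine ENNReal.ofReal_le_ofReal ?_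
      have := sq_nonneg ‖u 0 x‖
      nlinarith [hθ0 x, hθ1 x]
    · rw [indicator_of_notMem (show x ∉ {x : E | R₁ < ‖x‖} from hx), hθdef,
        radialCutoff_eq_one hR₁.le hR (not_lt.1 hx), sub_self, zero_mul, ENNReal.ofReal_zero]
  -- assembly
  calc ∫⁻ x in {x | R₂ < ‖x‖}, ‖u t x‖ₑ ^ 2 ≤ ENNReal.ofReal (g t) := hL
    _ ≤ ENNReal.ofReal (g 0 + Be.toReal) := ENNReal.ofReal_le_ofReal hlim
    _ ≤ ENNReal.ofReal (g 0) + ENNReal.ofReal Be.toReal := ENNReal.ofReal_add_le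
    _ ≤ (∫⁻ x in {x | R₁ < ‖x‖}, ‖u 0 x‖ₑ ^ 2) + Be := add_le_add hR ENNReal.ofReal_toReal_le
    _ ≤ (∫⁻ x in {x | R₁ < ‖x‖}, ‖u 0 x‖ₑ ^ 2) +
        ENNReal.ofReal (C₀ * lerayTailBound ν Cp (sobolevSixConst E) M t / (R₂ - R₁)) := by
        gcongr
        rwa [mul_div_right_comm]

/-- **Leray's separation of energy, in the printed form** (Ożański–Pooley 2018, Lemma 6.34:
`∫_{|x|>R₂}|u_ε(t)|² ≤ ∫_{|x|>R₁}|u₀|² + C(u₀, t)/(R₂ − R₁)`, `C(u₀, t) = C‖u₀‖²√t + C‖u₀‖³t^{1/4}`;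
Leray 1934, (5.7)): with `dim E = 3`, `ν > 0`, `C_p ≥ 0` there is `C ≥ 0` (depending on `ν`,
`C_p` and `E` only) such that every solution in the sense of `LerayTailHyp ν C_p` with
`‖u(0)‖₂ ≤ M` satisfies, for `0 < R₁ < R₂`, `t ≥ 0`,
`∫_{|x|>R₂}|u(t)|² ≤ ∫_{|x|>R₁}|u(0)|² + C(M³t^{1/4} + M²t^{1/2})/(R₂ − R₁)`. [cite: OzanskiPooley2018, Lemma 6.34] -/
theorem exists_leray_separation_of_energy' (hE : Module.finrank ℝ E = 3) {ν : ℝ} (hν : 0 < ν)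
    (Cp : ℝ≥0) :
    ∃ C : ℝ, 0 ≤ C ∧ ∀ ⦃w u : ℝ → E → E⦄ ⦃p : ℝ → E → ℝ⦄, LerayTailHyp ν Cp w u p →
      ∀ ⦃M : ℝ⦄, 0 ≤ M → eLpNorm (u 0) 2 volume ≤ ENNReal.ofReal M →
      ∀ (R₁ R₂ t : ℝ), 0 < R₁ → R₁ < R₂ → 0 ≤ t →
        ∫⁻ x in {x | R₂ < ‖x‖}, ‖u t x‖ₑ ^ 2 ≤
          (∫⁻ x in {x | R₁ < ‖x‖}, ‖u 0 x‖ₑ ^ 2) +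
            ENNReal.ofReal (C * (M ^ 3 * t ^ (1 / 4 : ℝ) + M ^ 2 * t ^ (1 / 2 : ℝ)) / (R₂ - R₁)) := by
  obtain ⟨C, hC0, hC⟩ := exists_leray_separation_of_energy hE hν Cp
  set C' : ℝ := max ((1 + 2 * (Cp : ℝ)) * (sobolevSixConst E : ℝ) ^ (3 / 2 : ℝ) * (2 * ν) ^ (-(3 / 4 : ℝ)))
    ((2 * ν) ^ (1 / 2 : ℝ)) with hC'
  have hC'0 : 0 ≤ C' := le_max_of_le_right (by positivity)
  refine ⟨C * C', mul_nonneg hC0 hC'0, fun w u p h M hM0 hM R₁ R₂ t hR₁ hR ht => ?_⟩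
  refine (hC h hM0 hM R₁ R₂ t hR₁ hR ht).trans (add_le_add le_rfl (ENNReal.ofReal_le_ofReal ?_))
  refine div_le_div_of_nonneg_right ?_ (sub_pos.2 hR).le
  calc C * lerayTailBound ν Cp (sobolevSixConst E) M t
      ≤ C * (C' * (M ^ 3 * t ^ (1 / 4 : ℝ) + M ^ 2 * t ^ (1 / 2 : ℝ))) :=
        mul_le_mul_of_nonneg_left (lerayTailBound_le hν Cp _ hM0 ht) hC0
    _ = C * C' * (M ^ 3 * t ^ (1 / 4 : ℝ) + M ^ 2 * t ^ (1 / 2 : ℝ)) := by ring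

end Final

end Literature.Analysis.FluidPDE

end
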